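import Mathlib.MeasureTheory.Integral.Bochner.Basic
import Mathlib.MeasureTheory.Measure.WithDensity
import Literature.Geometry.Lorentzian.BondiMassCauchy
import Literature.Geometry.Lorentzian.SecondFundamentalFormNormSq
import HarnessLib

/-!
# Bondi news flux of a Bondi foliation (family `gr`, topic T-LORENTZ)

`Literature.Geometry.Lorentzian.BondiMassCauchy` vendors, over the repaired development carrier
`DataEmbedding D` (hence `CauchyDevelopment D`, `VacuumCauchyDevelopment D` through
`toDataEmbedding`; `CauchyDevelopment.lean`), the hypothesis structure
`DataEmbedding.BondiFoliation 𝒮` of outgoing null cones `C⁺_u = ∂J⁺(ι (B u))` labelled by a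
future-increasing retarded time `u` and foliated by compact spacelike sections `S_{u,s}` receding to
infinity, the Bondi mass `bondiMass u = lim_s m_H(S_{u,s})` (Hawking masses,
`LorentzianMetric.hawkingMass` of `BondiMass.lean`), the final Bondi mass, and the hypothesis
structure `IsCanonical e` (Hawking masses converge; mass loss `Antitone bondiMass`; positivity;
`M_B ≤ E_ADM`). This file adds the **news side** of the Bondi–Sachs picture to that vocabulary,
intrinsically (no conformal boundary, no optical function), without re-declaring any of it:

1. pointwise: the **squared shear** `LorentzianMetric.nullShearNormSq` of a null normal of a
   spacelike immersed surface (`|χ̂_L|²_γ = |χ_L|²_γ - (dim S)⁻¹ θ_L²`, nonnegative for surfaces,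
   `nullShearNormSq_nonneg`), the boost-invariant **news density** of a section with null normal
   pair `(L, L̲)`, `LorentzianMetric.bondiNewsDensity`, `𝔫 = (|S|/16π) · θ_L² · |χ̂_{L̲}|²`, and its
   `ℝ≥0∞`-valued integral `LorentzianMetric.bondiNewsIntegral`;
2. along a Bondi foliation `𝓕 : 𝒮.BondiFoliation`: the section news integrals
   `𝓕.sectionNewsIntegral u s`, the **news power** `𝓕.newsPower u = limsup_{s → ∞}` of them
   (honest predicate `𝓕.HasNewsPower u p`), and the **news flux** `𝓕.newsFlux : Measure ℝ`, the
   measure `newsPower · du` on the retarded-time axis, so that `𝓕.newsFlux (Icc u₁ u₂)` is the flux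
   radiated through the portion `u₁ ≤ u ≤ u₂` of future null infinity, `𝓕.newsFlux (Ici u)` the
   flux radiated after `u` and `𝓕.newsFlux univ` the total flux (`newsFlux_apply`,
   `newsFlux_Icc_add_Icc`, `tendsto_newsFlux_Ici_of_ne_top`: finite total flux forces the late
   flux to vanish);
3. the **Bondi mass-loss formula** of the canonical (optical-function) foliations as the
   hypothesis structure `IsNewsCanonical e` extending `IsCanonical e` by two fields — convergence of
   the section news integrals along every cone, and the integrated mass-loss identity
   `newsFlux (Icc u₁ u₂) = 32π (M_B(u₁) - M_B(u₂))` — with its proved consequences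
   `IsNewsCanonical.bondiMass_sub_eq`, `.newsFlux_Icc_le`, `.newsFlux_Ici_eq`
   (`newsFlux (Ici u) = 32π (M_B(u) - M_B(+∞))`), `.newsFlux_univ_le` (total flux `≤ 32π E_ADM`),
   `.isFiniteMeasure_newsFlux`, and the "quiet at `𝓘⁺`" statement `.tendsto_newsFlux_Ici`:
   `newsFlux (Ici u) → 0` as `u → +∞`.

## Source, conventions and the constant `32π`

Christodoulou–Klainerman 1993, Ch. 17 (read on the held copy): for the surfaces `S_{t,u}` of the
canonical foliation of an outgoing cone `C_u`, with null pair `e₄ = T + N`, `e₃ = T - N`,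
`g(e₃, e₄) = -2` (the normalisation of `NullNormalPair`), null second fundamental forms `χ`, `χ̲`
and hats denoting `γ`-trace-free parts,

* Conclusion 17.0.3: `lim_{C_u, t → ∞} r θ̂ = -½ lim r χ̲̂' = Ξ(u, ·)`, a symmetric traceless
  `2`-tensor on `S²` (limits of components in `γ`-orthonormal frames; `|·|` w.r.t. the round
  metric `γ°`), with `∂_u Σ = -Ξ` for the asymptotic shear `Σ = lim r² χ̂'` (17.0.2);
* the Hawking mass `m(t,u) = (r/2)(1 + (16π)⁻¹ ∫_{S_{t,u}} tr χ tr χ̲)` (17.0.2), and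
  Conclusion 17.0.4: `m(t, u) → M(u)`, the Bondi mass, with the **Bondi mass formula**
  `∂M/∂u = (8π)⁻¹ ∫_{S²} |Ξ(u, ·)|² dμ_{γ°}`, derived from (17.0.7)
  `∂_u m(t,u) = (r/64π) ∫_{S_{t,u}} tr χ |χ̲̂|² dμ_γ + O(r⁻¹)` using `(r/2) tr χ → 1`,
  `r χ̲̂ → -2Ξ`; "M(u) is a nondecreasing function of u ... M(-∞) = 0 ... M(∞) is the total mass".

CK's optical function increases towards the *past* (Condition 9.2.1: "u is minus arc length" on the
central timelike line, (9.2.1a) `T^μ ∂_μ u = -1`; a radial function takes values onto `(u₀, ∞)`,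
increasing outward on each slice, Ch. 3), i.e. `u_CK = -u` for the retarded time `u` of
`BondiMass.lean`/`BondiMassCauchy.lean` and of this file, whence their "nondecreasing" is our
`Antitone bondiMass` and their `M(∞)`/`M(-∞)` are our `lim_{u → -∞} M_B ≤ E_ADM` / final Bondi
mass. In these conventions the per-section quantity `∫_{S_{u,s}} |χ̲̂|²_γ dμ_γ` (for the pair with
`(r/2) tr χ → 1`) tends to `4 ∫_{S²} |Ξ|² dμ_{γ°}` (`|χ̲̂|²_γ = r⁻² |r χ̲̂|²_{frame}` and
`dμ_γ = r² dμ_{γ̃}`, `γ̃ → γ°`), so that the mass formula reads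
`-dM_B/du = (32π)⁻¹ · lim_s ∫_{S_{u,s}} |χ̲̂|²_γ dμ_γ`; in Bondi's axisymmetric notation
(`γ_{AB} = r²(e^{2γ} dθ² + e^{-2γ} sin²θ dφ²)`, `γ = c/r + …`, news `c_u`) the limit integrand is
`8 c_u²`, recovering Bondi–van der Burg–Metzner's `m_u = -½ ∫₀^π c_u² sin θ dθ` (Proc. Roy. Soc.
A 269 (1962); restated with Bondi mass `m = (4π)⁻¹ ∮ M` and news `N = ∂_u c` as
`dm/du = -(4π)⁻¹ ∮ |N|²` in Mädler–Winicour, Scholarpedia 11 (2016) 33528, (56)–(57)) and Sachs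
(A 270 (1962)). The quantity `|χ̲̂|²` alone is **not** invariant under the residual boost freedom
`(L, L̲) ↦ (aL, a⁻¹L̲)` of a null normal pair (`χ_{aL} = a χ_L`, so `|χ̂_{a⁻¹L̲}|² = a⁻² |χ̂_{L̲}|²`),
whereas the structure `BondiFoliation` fixes the pair only up to this freedom; the combination
`θ_L² |χ̂_{L̲}|²` **is** boost invariant, and `(r²/4) θ_L² → 1` for the canonical pair
(`tr χ' = 2/r + O(r⁻²)`, CK Proof 17.0.5 and Conclusion 17.0.5: `r(r tr χ' - 2) → H`) with `r` the
area radius `|S_{u,s}| = 4πr²`. Hence the definition `𝔫 := (|S|/16π) θ_L² |χ̂_{L̲}|²` of the news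
density: gauge invariant, and equal to `|χ̲̂'|²(1 + o(1))` for CK's pair, so that
`∫_{S_{u,s}} 𝔫 dμ_γ → 4∫_{S²}|Ξ|² = ∫_{S²} |N|²_{γ°}` (`N_{AB} = ∂_u c_{AB} = -2 Ξ_{AB}` the news
tensor of the Bondi expansion `γ = r²γ° + r c + O(1)`) and
`M_B(u₁) - M_B(u₂) = (32π)⁻¹ newsFlux (Icc u₁ u₂)` — the field `IsNewsCanonical.newsFlux_Icc`.
As for `IsCanonical`, these identities are what the cited works prove for *their* foliations and
do not follow from the fields of `BondiFoliation` (CONVENTIONS: hypothesis structure, not a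
refutable sorried theorem).

## Mathlib

No Bondi mass, news or null infinity in Mathlib (at the pin). Used: `MeasureTheory.lintegral`,
`Measure.withDensity` (`withDensity_apply'`, `withDensity_absolutelyContinuous`), continuity of
measures along monotone families of intervals (`tendsto_measure_Ico_atTop`,
`tendsto_measure_Ici_atBot`, `tendsto_measure_iInter_atTop`), `Filter.limsup`,
`Filter.Tendsto.limsup_eq`, `ENNReal.ofReal`; from the project: `DataEmbedding.BondiFoliation`,
`bondiMass`, `finalBondiMass`, `IsCanonical` and its API (`BondiMassCauchy`), `NullNormalPair`,
`nullExpansion`, `nullSecondFundamentalForm` (`TrappedSurface`), `PseudoRiemannianMetric.normSq`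
and `half_meanCurvature_sq_le_normSq_secondFundamentalForm` (`MetricNormSq`,
`SecondFundamentalFormNormSq`), `riemannianVolume`/`totalArea` (`Volume`), `AFEnd.admEnergy`.

## References

* H. Bondi, M. G. J. van der Burg, A. W. K. Metzner, *Gravitational waves in general relativity
  VII*, Proc. Roy. Soc. A 269 (1962) 21–52 (mass aspect, news function, mass loss; paywalled,
  acquisition request acq-02908 — the mass-loss formula is quoted from its restatement in
  T. Mädler, J. Winicour, *Bondi–Sachs formalism*, Scholarpedia 11 (2016) 33528 =
  arXiv:1609.01731, (56)–(57): `m(u) = (4π)⁻¹ ∮ M`, `dm/du = -(4π)⁻¹ ∮ |N|²`, `N = ∂_u c`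
  axisymmetrically; `N_{AB} = ½ ∂_u c_{AB}` "to recover Bondi's original definition").
* R. K. Sachs, *Gravitational waves in general relativity VIII*, Proc. Roy. Soc. A 270 (1962)
  103–126.
* D. Christodoulou, S. Klainerman, *The global nonlinear stability of the Minkowski space*,
  Princeton 1993, Ch. 17, Conclusions 17.0.1–17.0.5, (17.0.2)–(17.0.7).
* D. Christodoulou, *The global initial value problem in general relativity*, Ninth Marcel
  Grossmann Meeting (2002) 44–54 (mass loss formula; acquisition request acq-03067).
* R. M. Wald, *General Relativity* (1984), §11.2 ((11.2.13): `E[𝒮₂] - E[𝒮₁] = -∫ f`, `f ≥ 0`).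
-/

noncomputable section

open Bundle Set Manifold TopologicalSpace Filter MeasureTheory Real
open scoped ContDiff Topology ENNReal

namespace Literature.Geometry.Lorentzian

/-! ### Shear of a null normal and the news density of a section -/

namespace LorentzianMetric

section Shear

variable {E : Type*} [NormedAddCommGroup E] [NormedSpace ℝ E] {H : Type*} [TopologicalSpace H]
  {I : ModelWithCorners ℝ E H} {M : Type*} [TopologicalSpace M] [ChartedSpace H M]
  {E'' : Type*} [NormedAddCommGroup E''] [NormedSpace ℝ E''] {H'' : Type*} [TopologicalSpace H'']
  {I'' : ModelWithCorners ℝ E'' H''} {S : Type*} [TopologicalSpace S] [ChartedSpace H'' S]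
  [IsManifold I ∞ M] {n : ℕ∞ω}
  [FiniteDimensional ℝ E] [CompleteSpace E] [Fact (1 ≤ n)] [FiniteDimensional ℝ E'']
  [IsManifold I'' ∞ S]
  (g : LorentzianMetric I n M) [g.HasLeviCivita] {τ : TimeOrientation g} (f : S → M)

/-- The **squared shear** `|χ̂_L(y)|²_{f^*g}` of the spacelike immersion `f : S → M` with respect
to the field `L` along `f` (meant: a null normal): the metric square norm, w.r.t. the induced
metric `γ = f^* g`, of the trace-free part `χ̂_L = χ_L - (dim S)⁻¹ (tr_γ χ_L) γ` of the null
second fundamental form `χ_L` (`nullSecondFundamentalForm`), written out as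
`|χ̂_L|² = |χ_L|²_γ - (dim S)⁻¹ θ_L²` (`normSq` of `PseudoRiemannianMetric.lean`, `θ_L` the null
expansion; the identity `|T - d⁻¹(tr T)γ|²_γ = |T|²_γ - d⁻¹ (tr T)²`, `d = dim S = |γ|²_γ`, holds
for every bilinear `T`). Meant for `dim S = 2`, where it is nonnegative
(`nullShearNormSq_nonneg`). Under the boost `L ↦ aL` it scales by `a²`. Christodoulou–Klainerman
1993, Ch. 17 (the shears `χ̂`, `χ̲̂`, `|χ̲̂|²` in (17.0.7)); Hawking–Ellis 1973, §4.2 (shear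
`σ̂_{ab}` of a null congruence). [cite: ChristodoulouKlainerman1993, Ch. 17, (17.0.7)] -/
def nullShearNormSq (hpb : PseudoRiemannianMetric.contMDiff_pullbackBilin I M I'' S n)
    (hf : g.IsSpacelikeImmersion I'' f) (L : NormalField I f) (y : S) : ℝ :=
  (g.inducedMetric f hpb hf).normSq y (g.nullSecondFundamentalForm I'' f L y) -
    (Module.finrank ℝ E'' : ℝ)⁻¹ * g.nullExpansion f hpb hf L y ^ 2

omit [CompleteSpace E] [Fact (1 ≤ n)] in
/-- Unfolding lemma for the squared shear. [folklore] -/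
lemma nullShearNormSq_eq (hpb : PseudoRiemannianMetric.contMDiff_pullbackBilin I M I'' S n)
    (hf : g.IsSpacelikeImmersion I'' f) (L : NormalField I f) (y : S) :
    g.nullShearNormSq f hpb hf L y =
      (g.inducedMetric f hpb hf).normSq y (g.secondFundamentalForm I'' f L y) -
        (Module.finrank ℝ E'' : ℝ)⁻¹ * g.meanCurvature f hpb hf L y ^ 2 :=
  rfl

variable [CompactSpace S] [T2Space S] [MeasurableSpace S] [BorelSpace S]

/-- The **news density** of the compact spacelike immersed surface `f : S → M` with null normal
pair `P = (L, L̲)` (`g(L, L̲) = -2`, `L` outgoing): the function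
`𝔫_P(y) = (|S| / 16π) · θ_L(y)² · |χ̂_{L̲}(y)|²`, where `|S| = totalArea (f^* g)` is the area,
`θ_L` the outgoing null expansion and `|χ̂_{L̲}|²` the squared shear of the *ingoing* null normal
(`nullShearNormSq`). It is invariant under the boosts `(L, L̲) ↦ (aL, a⁻¹L̲)` (`θ_{aL} = aθ_L`,
`|χ̂_{a⁻¹L̲}|² = a⁻²|χ̂_{L̲}|²`), and for the sections `S_{t,u}` of a canonical foliation of an
outgoing cone, where `|S| = 4πr²` and `(r/2) θ_L → 1` (Christodoulou–Klainerman 1993, Proof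
17.0.5: `tr χ' = 2/r + O(r⁻²)`), it equals `|χ̲̂'|² (1 + o(1))` with `r χ̲̂' → -2Ξ` (Conclusion
17.0.3), so that
`∫_S 𝔫 dA → 4 ∫_{S²} |Ξ|² dμ_{γ°} = ∫_{S²} |N|²` (`N = -2Ξ` the news tensor) — the integrand of
the Bondi mass formula `∂M/∂u = (8π)⁻¹ ∫ |Ξ|²` of Conclusion 17.0.4 (in CK's past-increasing `u`).
Meant for `dim S = 2`, `dim M = 4`; junk value `toReal ⊤ = 0` of the area for non-compact images
(none for compact `S`, `riemannianVolume_lt_top_of_isCompact`).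
[cite: ChristodoulouKlainerman1993, Ch. 17, Conclusions 17.0.3–17.0.4] -/
def bondiNewsDensity (hpb : PseudoRiemannianMetric.contMDiff_pullbackBilin I M I'' S n)
    (hf : g.IsSpacelikeImmersion I'' f) (P : NullNormalPair I'' g τ f) (y : S) : ℝ :=
  (totalArea (g.inducedRiemannianMetric f hpb hf)).toReal / (16 * π) *
    (g.nullExpansion f hpb hf P.L y ^ 2 * g.nullShearNormSq f hpb hf P.Lbar y)

/-- The **news integral** `∫_S 𝔫_P dA ∈ [0, ∞]` of the compact spacelike immersed surface
`f : S → M` with null normal pair `P`: the lower Lebesgue integral of (the positive part of) the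
news density `bondiNewsDensity` against the area measure `dA = riemannianVolume (f^* g) 2`. Along
the sections of a canonical foliation of an outgoing null cone it converges to
`4 ∫_{S²} |Ξ|² dμ_{γ°}`, i.e. to `32π · (-dM_B/du)` (Christodoulou–Klainerman 1993, Conclusion
17.0.4, in the future-increasing retarded time of this file).
[cite: ChristodoulouKlainerman1993, Ch. 17, Conclusion 17.0.4] -/
def bondiNewsIntegral (hpb : PseudoRiemannianMetric.contMDiff_pullbackBilin I M I'' S n)
    (hf : g.IsSpacelikeImmersion I'' f) (P : NullNormalPair I'' g τ f) : ℝ≥0∞ :=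
  ∫⁻ y, ENNReal.ofReal (g.bondiNewsDensity f hpb hf P y)
    ∂(riemannianVolume (g.inducedRiemannianMetric f hpb hf) 2)

omit [CompleteSpace E] [Fact (1 ≤ n)] in
/-- A section whose ingoing null normal is shear-free (`|χ̂_{L̲}|² ≡ 0`; e.g. the round cuts of an
outgoing cone of Minkowski or Schwarzschild space) has vanishing news density: no radiation.
Bondi–van der Burg–Metzner 1962 (no news, no mass loss). [cite: BondiVanderburgMetzner1962, mass-loss formula] [cite: MadlerWinicour2016, (56)–(57)] -/
lemma bondiNewsDensity_eq_zero_of_nullShearNormSq_eq_zero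
    (hpb : PseudoRiemannianMetric.contMDiff_pullbackBilin I M I'' S n)
    (hf : g.IsSpacelikeImmersion I'' f) (P : NullNormalPair I'' g τ f) {y : S}
    (h : g.nullShearNormSq f hpb hf P.Lbar y = 0) : g.bondiNewsDensity f hpb hf P y = 0 := by
  simp [bondiNewsDensity, h]

omit [CompleteSpace E] [Fact (1 ≤ n)] in
/-- A section whose ingoing null normal is everywhere shear-free has vanishing news integral.
Bondi–van der Burg–Metzner 1962. [cite: BondiVanderburgMetzner1962, mass-loss formula] [cite: MadlerWinicour2016, (56)–(57)] -/
lemma bondiNewsIntegral_eq_zero_of_nullShearNormSq_eq_zero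
    (hpb : PseudoRiemannianMetric.contMDiff_pullbackBilin I M I'' S n)
    (hf : g.IsSpacelikeImmersion I'' f) (P : NullNormalPair I'' g τ f)
    (h : ∀ y, g.nullShearNormSq f hpb hf P.Lbar y = 0) : g.bondiNewsIntegral f hpb hf P = 0 := by
  simp [bondiNewsIntegral, g.bondiNewsDensity_eq_zero_of_nullShearNormSq_eq_zero f hpb hf P (h _)]

end Shear

section Surface

variable {E : Type*} [NormedAddCommGroup E] [NormedSpace ℝ E] {H : Type*} [TopologicalSpace H]
  {I : ModelWithCorners ℝ E H} {M : Type*} [TopologicalSpace M] [ChartedSpace H M]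
  {S : Type*} [TopologicalSpace S] [ChartedSpace (EuclideanSpace ℝ (Fin 2)) S]
  [IsManifold I ∞ M] {n : ℕ∞ω}
  [FiniteDimensional ℝ E] [CompleteSpace E] [Fact (1 ≤ n)]
  [IsManifold (𝓡 2) ∞ S]
  (g : LorentzianMetric I n M) [g.HasLeviCivita] {τ : TimeOrientation g} (f : S → M)

omit [CompleteSpace E] [Fact (1 ≤ n)] in
/-- **The squared shear of a surface is nonnegative**: for `dim S = 2`,
`|χ̂_L|² = |χ_L|²_γ - ½ θ_L² ≥ 0`, the case `d = 2` of `(tr_γ T)² ≤ d |T|²_γ` for the Riemannian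
induced metric (`half_meanCurvature_sq_le_normSq_secondFundamentalForm`). Huisken–Ilmanen 2001, §5
(`|A|² = ½H² + ½(λ₁-λ₂)²`). [cite: HuiskenIlmanenIMCF2001, §5] -/
lemma nullShearNormSq_nonneg
    (hpb : PseudoRiemannianMetric.contMDiff_pullbackBilin I M (𝓡 2) S n)
    (hf : g.IsSpacelikeImmersion (𝓡 2) f) (L : NormalField I f) (y : S) :
    0 ≤ g.nullShearNormSq f hpb hf L y := by
  have h := g.toPseudoRiemannianMetric.half_meanCurvature_sq_le_normSq_secondFundamentalForm
    f hpb hf L y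
  have h2 : (Module.finrank ℝ (EuclideanSpace ℝ (Fin 2)) : ℝ)⁻¹ = 2⁻¹ := by
    rw [finrank_euclideanSpace_fin, Nat.cast_ofNat]
  rw [nullShearNormSq_eq, h2, sub_nonneg]
  exact h

variable [CompactSpace S] [T2Space S] [MeasurableSpace S] [BorelSpace S]

omit [CompleteSpace E] [Fact (1 ≤ n)] in
/-- The news density of a surface (`dim S = 2`) is nonnegative. Christodoulou–Klainerman 1993,
Ch. 17, Conclusion 17.0.4 ("the right-hand side of the Bondi mass formula is positive").
[cite: ChristodoulouKlainerman1993, Ch. 17, Conclusion 17.0.4] -/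
lemma bondiNewsDensity_nonneg
    (hpb : PseudoRiemannianMetric.contMDiff_pullbackBilin I M (𝓡 2) S n)
    (hf : g.IsSpacelikeImmersion (𝓡 2) f) (P : NullNormalPair (𝓡 2) g τ f) (y : S) :
    0 ≤ g.bondiNewsDensity f hpb hf P y :=
  mul_nonneg (div_nonneg ENNReal.toReal_nonneg (by positivity))
    (mul_nonneg (sq_nonneg _) (g.nullShearNormSq_nonneg f hpb hf P.Lbar y))

end Surface

end LorentzianMetric

/-! ### News along a Bondi foliation of a data embedding -/

universe u

variable {X : Type u} [TopologicalSpace X] [ChartedSpace E3 X] [IsManifold (𝓡 3) ∞ X]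
  [ConnectedSpace X] {D : InitialDataSet (𝓡 3) X}

namespace DataEmbedding.BondiFoliation

variable {𝒮 : DataEmbedding D} (𝓕 : 𝒮.BondiFoliation)

/-! #### News of the sections, news power and the news flux measure -/

/-- The **news integral of the section `S_{u,s}`**: `∫_{S_{u,s}} 𝔫 dA ∈ [0, ∞]`
(`LorentzianMetric.bondiNewsIntegral` of the section w.r.t. its bundled null normal pair), the
boost-invariant rendering of `∫_{S_{t,u}} |χ̲̂|² dμ_γ`; along a canonical foliation it tends to
`4 ∫_{S²} |Ξ(u, ·)|² dμ_{γ°}` as `s → ∞` (Christodoulou–Klainerman 1993, Conclusions 17.0.3–17.0.4).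
[cite: ChristodoulouKlainerman1993, Ch. 17, Conclusions 17.0.3–17.0.4] -/
def sectionNewsIntegral (u s : ℝ) : ℝ≥0∞ :=
  haveI := 𝓕.hasLeviCivita
  𝒮.metric.bondiNewsIntegral (𝓕.sec u s) 𝓕.hpb (𝓕.isSpacelike u s) (𝓕.pair u s)

/-- The Bondi foliation **has news power `p` at retarded time `u`**: the news integrals of the
sections `S_{u,s}` converge to `p ∈ [0, ∞]` as `s → ∞` (for a canonical foliation
`p = 4 ∫_{S²} |Ξ(u, ·)|² dμ_{γ°}`, Christodoulou–Klainerman 1993, Conclusion 17.0.3 and the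
remark in Proof 17.0.7). [cite: ChristodoulouKlainerman1993, Ch. 17, Conclusion 17.0.3] -/
def HasNewsPower (u : ℝ) (p : ℝ≥0∞) : Prop :=
  Tendsto (𝓕.sectionNewsIntegral u) atTop (𝓝 p)

/-- The **news power** `𝒫(u) = limsup_{s → ∞} ∫_{S_{u,s}} 𝔫 dA ∈ [0, ∞]` radiated at retarded
time `u`: the upper limit of the section news integrals along the cone `C⁺_u` (the limit when it
exists, `HasNewsPower.newsPower_eq`). For a canonical foliation `𝒫(u) = 4 ∫_{S²}|Ξ(u,·)|² =
∫_{S²} |N(u,·)|²_{γ°}` (news tensor `N`), i.e. `𝒫 = -32π dM_B/du` (Christodoulou–Klainerman 1993,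
Conclusion 17.0.4; Bondi–van der Burg–Metzner 1962).
[cite: ChristodoulouKlainerman1993, Ch. 17, Conclusion 17.0.4] -/
def newsPower (u : ℝ) : ℝ≥0∞ :=
  limsup (𝓕.sectionNewsIntegral u) atTop

/-- The **Bondi news flux** of the foliation, as a measure on the retarded-time axis:
`newsFlux = 𝒫(u) du` (Lebesgue measure with density the news power), so that
`newsFlux (Icc u₁ u₂) = ∫_{u₁}^{u₂} 𝒫(u) du ∈ [0, ∞]` is the flux radiated through the portion
`u₁ ≤ u ≤ u₂` of future null infinity, `newsFlux (Ici u)` the flux radiated after `u`, and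
`newsFlux univ` the total flux (`newsFlux_apply`). For a canonical foliation
`newsFlux (Icc u₁ u₂) = 32π (M_B(u₁) - M_B(u₂))` (`IsNewsCanonical.newsFlux_Icc`, the integrated
Bondi mass-loss formula; Bondi–van der Burg–Metzner 1962; Christodoulou–Klainerman 1993,
Conclusion 17.0.4).

**Interface note for route consumers** (definition request `defn-BondiNewsFlux` of route
TwoBoundarySqueeze asked informally for `newsFlux (u₁ u₂ : ℝ) : ℝ≥0∞` with
`M_B(u₁) - M_B(u₂) = (4π)⁻¹ · newsFlux u₁ u₂`). Deliberate deviations: (i) the flux is a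
`Measure ℝ`, the requested two-time quantity being `𝓕.newsFlux (Icc u₁ u₂)` (and "`newsFlux u ∞`"
being `𝓕.newsFlux (Ici u)`), so that monotonicity, additivity over windows and continuity in the
endpoints are Mathlib's measure API; (ii) the normalisation is that of the tensor news
`|N|²_{γ°} = |∂_u c_{AB}|²_{γ°}` (`= 4|Ξ|²` in CK's notation, `= 8 c_u²` in Bondi's axisymmetric
notation), for which the mass-loss constant is `(32π)⁻¹`, not the `(4π)⁻¹` that goes with Bondi's
news function `c_u` / Sachs' complex news: `M_B(u₁) - M_B(u₂) = (32π)⁻¹ (newsFlux (Icc u₁ u₂)).toReal`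
(`IsNewsCanonical.bondiMass_sub_eq`). [cite: ChristodoulouKlainerman1993, Ch. 17, Conclusion 17.0.4] -/
def newsFlux : Measure ℝ :=
  volume.withDensity 𝓕.newsPower

variable {𝓕}

/-- If the section news integrals along `C⁺_u` converge to `p`, the news power at `u` is `p`.
[folklore] -/
lemma HasNewsPower.newsPower_eq {u : ℝ} {p : ℝ≥0∞} (h : 𝓕.HasNewsPower u p) :
    𝓕.newsPower u = p :=
  h.limsup_eq

/-- If the news power exists at every retarded time, `HasNewsPower u (newsPower u)`. [folklore] -/
lemma hasNewsPower_newsPower (h : ∀ u, ∃ p, 𝓕.HasNewsPower u p) (u : ℝ) :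
    𝓕.HasNewsPower u (𝓕.newsPower u) := by
  obtain ⟨p, hp⟩ := h u
  rwa [hp.newsPower_eq]

variable (𝓕)

/-- The news flux of a set `s` of retarded times is `∫_{u ∈ s} 𝒫(u) du` (Mathlib's
`withDensity_apply'`, no measurability needed as Lebesgue measure is s-finite). [folklore] -/
lemma newsFlux_apply (s : Set ℝ) : 𝓕.newsFlux s = ∫⁻ u in s, 𝓕.newsPower u :=
  withDensity_apply' _ s

/-- The news flux is absolutely continuous with respect to Lebesgue measure on the retarded-time
axis. [folklore] -/
lemma newsFlux_absolutelyContinuous : 𝓕.newsFlux ≪ volume :=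
  withDensity_absolutelyContinuous _ _

/-- A single retarded time carries no flux. [folklore] -/
@[simp]
lemma newsFlux_singleton (u : ℝ) : 𝓕.newsFlux {u} = 0 :=
  𝓕.newsFlux_absolutelyContinuous Real.volume_singleton

/-- The flux through `u₁ ≤ u ≤ u₂` equals the flux through `u₁ < u ≤ u₂`. [folklore] -/
lemma newsFlux_Icc_eq_Ioc (u₁ u₂ : ℝ) : 𝓕.newsFlux (Icc u₁ u₂) = 𝓕.newsFlux (Ioc u₁ u₂) :=
  (measure_congr (Ioc_ae_eq_Icc' (𝓕.newsFlux_singleton u₁))).symm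

/-- The flux through `u₁ ≤ u ≤ u₂` equals the flux through `u₁ ≤ u < u₂`. [folklore] -/
lemma newsFlux_Icc_eq_Ico (u₁ u₂ : ℝ) : 𝓕.newsFlux (Icc u₁ u₂) = 𝓕.newsFlux (Ico u₁ u₂) :=
  (measure_congr (Ico_ae_eq_Icc' (𝓕.newsFlux_singleton u₂))).symm

/-- The flux radiated after `u` may be computed on `u' ≥ u` or on `u' > u`. [folklore] -/
lemma newsFlux_Ici_eq_Ioi (u : ℝ) : 𝓕.newsFlux (Ici u) = 𝓕.newsFlux (Ioi u) :=
  (measure_congr (Ioi_ae_eq_Ici' (𝓕.newsFlux_singleton u))).symm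

/-- Additivity of the flux over consecutive retarded-time windows:
`newsFlux [u₁, u₂] + newsFlux [u₂, u₃] = newsFlux [u₁, u₃]` for `u₁ ≤ u₂ ≤ u₃`. [folklore] -/
lemma newsFlux_Icc_add_Icc {u₁ u₂ u₃ : ℝ} (h₁₂ : u₁ ≤ u₂) (h₂₃ : u₂ ≤ u₃) :
    𝓕.newsFlux (Icc u₁ u₂) + 𝓕.newsFlux (Icc u₂ u₃) = 𝓕.newsFlux (Icc u₁ u₃) := by
  have hd : Disjoint (Icc u₁ u₂) (Ioc u₂ u₃) :=
    Set.disjoint_left.2 fun u hu hu' ↦ (not_lt.2 hu.2) hu'.1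
  rw [𝓕.newsFlux_Icc_eq_Ioc u₂ u₃, ← measure_union hd measurableSet_Ioc,
    Icc_union_Ioc_eq_Icc h₁₂ h₂₃]

/-- **Finite total flux forces the late flux to vanish**: if `newsFlux univ < ∞` then
`newsFlux (Ici u) → 0` as `u → +∞` (continuity of the measure from above along the antitone
family `Ici u`, whose intersection is empty). This is the form in which "the news is square
integrable on `𝓘⁺`, hence the radiation through `𝓘⁺` after time `u` tends to zero" enters
late-time arguments. [folklore] -/
theorem tendsto_newsFlux_Ici_of_ne_top (h : 𝓕.newsFlux univ ≠ ⊤) :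
    Tendsto (fun u ↦ 𝓕.newsFlux (Ici u)) atTop (𝓝 0) := by
  have hempty : ⋂ u : ℝ, Ici u = ∅ :=
    iInter_eq_empty_iff.2 fun u ↦ ⟨u + 1, fun hu ↦ by have hu' := mem_Ici.1 hu; linarith⟩
  have ht : Tendsto (fun u : ℝ ↦ 𝓕.newsFlux (Ici u)) atTop (𝓝 (𝓕.newsFlux (⋂ u : ℝ, Ici u))) :=
    tendsto_measure_iInter_atTop (μ := 𝓕.newsFlux) (s := fun u : ℝ ↦ Ici u)
      (fun _ ↦ measurableSet_Ici.nullMeasurableSet) (fun _ _ huv ↦ Ici_subset_Ici.2 huv)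
      ⟨0, ne_top_of_le_ne_top h (measure_mono (subset_univ _))⟩
  rwa [hempty, measure_empty] at ht

/-! #### Canonical foliations with news (hypothesis structure) -/

/-- Hypothesis structure: `𝓕` is a **canonical Bondi foliation with news** for the end `e`:
a canonical Bondi foliation (`IsCanonical`) for which, moreover, the news side of
Christodoulou–Klainerman 1993, Ch. 17 holds:

* the section news integrals converge along every cone (`hasNewsPower`; CK Conclusion 17.0.3:
  `r χ̲̂' → -2Ξ`, `γ̃ → γ°`, whence `∫_{S_{t,u}} |χ̲̂|² dμ_γ → 4∫_{S²}|Ξ|²`, cf. the remark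
  `∫_{S_{t,u'}} aφ|k|² → ∫_{S²}|Ξ|²` in Proof 17.0.7, `k` the second fundamental form of the
  maximal slices, whose `S`-tangential trace-free part `η̂` has `r η̂ → Ξ`);
* the **integrated Bondi mass-loss formula** (`newsFlux_Icc`): for `u₁ ≤ u₂`,
  `newsFlux (Icc u₁ u₂) = 32π (M_B(u₁) - M_B(u₂))`, i.e. `-dM_B/du = (32π)⁻¹ 𝒫(u)` with
  `𝒫(u) = 4∫_{S²}|Ξ|² dμ_{γ°}` — CK Conclusion 17.0.4, `∂M/∂u = (8π)⁻¹ ∫_{S²} |Ξ|² dμ_{γ°}` in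
  their past-increasing `u`; equivalently Bondi–van der Burg–Metzner 1962,
  `m_u = -½ ∫₀^π c_u² sin θ dθ`, and Sachs 1962 (`𝒫 = ∮ |N|²_{γ°} = 8 ∮ c_u²` axisymmetrically).

See the module docstring for the normalisations, and the interface note on `newsFlux`: the
mass-loss constant is `(32π)⁻¹` for this (tensor-news) normalisation of the flux — the informal
`(4π)⁻¹` of the definition request `defn-BondiNewsFlux` belongs to Bondi's news function `c_u`,
`|N|²_{γ°} = 8 c_u²` — and the requested `newsFlux u₁ u₂` is `𝓕.newsFlux (Icc u₁ u₂)`. As for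
`IsCanonical`, the fields are what the cited works prove for their foliations, not consequences of
the structure `BondiFoliation`. [cite: ChristodoulouKlainerman1993, Ch. 17, Conclusions 17.0.3–17.0.4]
[cite: BondiVanderburgMetzner1962, mass-loss formula] [cite: MadlerWinicour2016, (56)–(57)] -/
structure IsNewsCanonical (e : AFEnd X) : Prop extends 𝓕.IsCanonical e where
  /-- The section news integrals converge along every outgoing cone `C⁺_u` (CK 1993, 17.0.3). -/
  hasNewsPower (u : ℝ) : ∃ p, 𝓕.HasNewsPower u p
  /-- Integrated Bondi mass-loss formula (BvdBM 1962; CK 1993, 17.0.4):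
  `newsFlux [u₁, u₂] = 32π (M_B(u₁) - M_B(u₂))` for `u₁ ≤ u₂`. -/
  newsFlux_Icc (u₁ u₂ : ℝ) (h : u₁ ≤ u₂) :
    𝓕.newsFlux (Icc u₁ u₂) = ENNReal.ofReal (32 * π * (𝓕.bondiMass u₁ - 𝓕.bondiMass u₂))

variable {𝓕} {e : AFEnd X}

/-! #### Consequences of the mass-loss formula -/

/-- For a canonical foliation with news, `HasNewsPower u (newsPower u)` at every retarded time
(Christodoulou–Klainerman 1993, Ch. 17, Conclusion 17.0.3). [cite: ChristodoulouKlainerman1993, Ch. 17, Conclusion 17.0.3] -/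
lemma IsNewsCanonical.hasNewsPower_newsPower (hc : 𝓕.IsNewsCanonical e) (u : ℝ) :
    𝓕.HasNewsPower u (𝓕.newsPower u) :=
  BondiFoliation.hasNewsPower_newsPower hc.hasNewsPower u

/-- **Integrated Bondi mass-loss formula**, all windows: for a canonical foliation with news,
`newsFlux (Icc u₁ u₂) = 32π (M_B(u₁) - M_B(u₂))⁺` for all `u₁, u₂` (for `u₂ < u₁` both sides
vanish, by antitonicity). Bondi–van der Burg–Metzner 1962; Christodoulou–Klainerman 1993,
Ch. 17, Conclusion 17.0.4. [cite: ChristodoulouKlainerman1993, Ch. 17, Conclusion 17.0.4] -/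
theorem IsNewsCanonical.newsFlux_Icc_eq (hc : 𝓕.IsNewsCanonical e) (u₁ u₂ : ℝ) :
    𝓕.newsFlux (Icc u₁ u₂) = ENNReal.ofReal (32 * π * (𝓕.bondiMass u₁ - 𝓕.bondiMass u₂)) := by
  rcases le_or_gt u₁ u₂ with h | h
  · exact hc.newsFlux_Icc u₁ u₂ h
  · rw [Icc_eq_empty (not_le.2 h), measure_empty, eq_comm, ENNReal.ofReal_eq_zero]
    exact mul_nonpos_iff.2 (Or.inl ⟨by positivity, sub_nonpos.2 (hc.bondiMass_antitone h.le)⟩)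

/-- **Bondi mass loss as an identity**: for a canonical foliation with news and `u₁ ≤ u₂`,
`M_B(u₁) - M_B(u₂) = (32π)⁻¹ · newsFlux (Icc u₁ u₂)` (the flux is finite). Bondi–van der Burg–
Metzner 1962 (`m_u = -½∫ c_u² sin θ dθ`; Mädler–Winicour 2016, (57)); Christodoulou–Klainerman
1993, Ch. 17, Conclusion 17.0.4 (`∂M/∂u = (8π)⁻¹∫|Ξ|²` in their conventions).
[cite: BondiVanderburgMetzner1962, mass-loss formula] [cite: MadlerWinicour2016, (56)–(57)]
[cite: ChristodoulouKlainerman1993, Ch. 17, Conclusion 17.0.4] -/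
theorem IsNewsCanonical.bondiMass_sub_eq (hc : 𝓕.IsNewsCanonical e) {u₁ u₂ : ℝ} (h : u₁ ≤ u₂) :
    𝓕.bondiMass u₁ - 𝓕.bondiMass u₂ = (32 * π)⁻¹ * (𝓕.newsFlux (Icc u₁ u₂)).toReal := by
  have h0 : 0 ≤ 𝓕.bondiMass u₁ - 𝓕.bondiMass u₂ := sub_nonneg.2 (hc.bondiMass_antitone h)
  have hπ : (32 * π) ≠ 0 := by positivity
  rw [hc.newsFlux_Icc u₁ u₂ h, ENNReal.toReal_ofReal (mul_nonneg (by positivity) h0),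
    ← mul_assoc, inv_mul_cancel₀ hπ, one_mul]

/-- The flux through any window is bounded by `32π E_ADM` (mass loss, positivity of the Bondi
mass and `M_B ≤ E_ADM`). Christodoulou–Klainerman 1993, Ch. 17, Conclusion 17.0.4. [cite: ChristodoulouKlainerman1993, Ch. 17, Conclusion 17.0.4] -/
theorem IsNewsCanonical.newsFlux_Icc_le (hc : 𝓕.IsNewsCanonical e) (u₁ u₂ : ℝ) :
    𝓕.newsFlux (Icc u₁ u₂) ≤ ENNReal.ofReal (32 * π * AFEnd.admEnergy e D) := by
  rw [hc.newsFlux_Icc_eq]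
  refine ENNReal.ofReal_le_ofReal (mul_le_mul_of_nonneg_left ?_ (by positivity))
  linarith [hc.bondiMass_le_admEnergy u₁, hc.bondiMass_nonneg u₂]

/-- **The flux radiated after `u`** is `32π (M_B(u) - M_B(+∞))` for a canonical foliation with
news (continuity of the measure along `Ico u v ↑ Ici u` and `M_B(v) → M_B(+∞)`).
Christodoulou–Klainerman 1993, Ch. 17, Conclusion 17.0.4. [cite: ChristodoulouKlainerman1993, Ch. 17, Conclusion 17.0.4] -/
theorem IsNewsCanonical.newsFlux_Ici_eq (hc : 𝓕.IsNewsCanonical e) (u : ℝ) :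
    𝓕.newsFlux (Ici u) = ENNReal.ofReal (32 * π * (𝓕.bondiMass u - 𝓕.finalBondiMass)) := by
  have h1 : Tendsto (fun v ↦ 𝓕.newsFlux (Ico u v)) atTop (𝓝 (𝓕.newsFlux (Ici u))) :=
    tendsto_measure_Ico_atTop _ u
  have h2 : Tendsto (fun v ↦ 𝓕.newsFlux (Ico u v)) atTop
      (𝓝 (ENNReal.ofReal (32 * π * (𝓕.bondiMass u - 𝓕.finalBondiMass)))) := by
    have hM : Tendsto 𝓕.bondiMass atTop (𝓝 𝓕.finalBondiMass) := hc.tendsto_bondiMass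
    have h3 := ENNReal.tendsto_ofReal ((hM.const_sub (𝓕.bondiMass u)).const_mul (32 * π))
    refine Tendsto.congr (fun v ↦ ?_) h3
    show ENNReal.ofReal (32 * π * (𝓕.bondiMass u - 𝓕.bondiMass v)) = 𝓕.newsFlux (Ico u v)
    rw [← hc.newsFlux_Icc_eq, 𝓕.newsFlux_Icc_eq_Ico]
  exact tendsto_nhds_unique h1 h2

/-- **The total flux is at most `32π E_ADM`** for a canonical foliation with news (indeed at most
`32π (lim_{u → -∞} M_B - M_B(+∞))`). Christodoulou–Klainerman 1993, Ch. 17, Conclusion 17.0.4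
("M(-∞) = 0 ... M(∞) is the total mass": the total radiated energy is at most the total mass).
[cite: ChristodoulouKlainerman1993, Ch. 17, Conclusion 17.0.4] -/
theorem IsNewsCanonical.newsFlux_univ_le (hc : 𝓕.IsNewsCanonical e) :
    𝓕.newsFlux univ ≤ ENNReal.ofReal (32 * π * AFEnd.admEnergy e D) := by
  refine le_of_tendsto' (tendsto_measure_Ici_atBot 𝓕.newsFlux) fun u ↦ ?_
  show 𝓕.newsFlux (Ici u) ≤ _
  rw [hc.newsFlux_Ici_eq]
  refine ENNReal.ofReal_le_ofReal (mul_le_mul_of_nonneg_left ?_ (by positivity))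
  linarith [hc.bondiMass_le_admEnergy u, finalBondiMass_nonneg hc.toIsCanonical]

/-- For a canonical foliation with news the news flux is a finite measure on the retarded-time
axis ("the news is square integrable on `𝓘⁺`"). Christodoulou–Klainerman 1993, Ch. 17,
Conclusion 17.0.4 ("the right-hand side of the Bondi mass formula is positive and integrable in
u"). [cite: ChristodoulouKlainerman1993, Ch. 17, Conclusion 17.0.4] -/
theorem IsNewsCanonical.isFiniteMeasure_newsFlux (hc : 𝓕.IsNewsCanonical e) :
    IsFiniteMeasure 𝓕.newsFlux :=
  ⟨hc.newsFlux_univ_le.trans_lt ENNReal.ofReal_lt_top⟩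

/-- **Quiet at `𝓘⁺`**: for a canonical foliation with news, the flux radiated after retarded time
`u` tends to zero as `u → +∞` (`= 32π (M_B(u) - M_B(+∞)) → 0`). Christodoulou–Klainerman 1993,
Ch. 17, Conclusion 17.0.4; Bondi–van der Burg–Metzner 1962. [cite: ChristodoulouKlainerman1993, Ch. 17, Conclusion 17.0.4] -/
theorem IsNewsCanonical.tendsto_newsFlux_Ici (hc : 𝓕.IsNewsCanonical e) :
    Tendsto (fun u ↦ 𝓕.newsFlux (Ici u)) atTop (𝓝 0) :=
  𝓕.tendsto_newsFlux_Ici_of_ne_top (hc.newsFlux_univ_le.trans_lt ENNReal.ofReal_lt_top).ne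

end DataEmbedding.BondiFoliation

end Literature.Geometry.Lorentzian

end
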